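import HarnessLib
import Mathlib.NumberTheory.DirichletCharacter.Basic
import Mathlib.NumberTheory.MulChar.Basic
import Mathlib.Analysis.Complex.Basic

/-!
# GRH arm (rh-explicit, venture WeilGRH): unit groups of small moduli and real Dirichlet characters (bookkeeping)

Cell `rh-explicit`, WEIL TRACK — GRH ARM (engine seat weil-grh-2 gen10).  Kernel-decided facts about `(ℤ/q)ˣ` for the small moduli
that the per-rung ASSEMBLIES of the arm (`LogTwoRealComplete.lean`, `FrontierRealComplete.lean`, gen9's `FiftynineRealComplete.lean`)
reduce a general non-principal REAL character to the finitely many kernel-checked χ-cells: generators (`(ℤ/q)ˣ = ⟨g⟩` as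
`∀ u, ∃ k < m, u = g^k`, by `decide`), the kernels of the reductions `(ℤ/6)ˣ → (ℤ/3)ˣ`, `(ℤ/10)ˣ → (ℤ/5)ˣ`, `(ℤ/9)ˣ → (ℤ/3)ˣ`,
`(ℤ/15)ˣ → (ℤ/5)ˣ`, `(ℤ/8)ˣ → (ℤ/4)ˣ`, `(ℤ/16)ˣ → (ℤ/8)ˣ`, the resulting `FactorsThrough` lemmas, and two one-liners on real
characters (`χ x ∈ {0, ±1}`).  Pure finite bookkeeping; RH/GRH-free; standard axioms.
-/

noncomputable section

open DirichletCharacter Complex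

namespace Summit.Ventures.WeilGRH.RealCharacterSmallModuli

variable {q : ℕ}

/-! ## Generic -/

/-- If every unit of `ℤ/q` is a power of `g` and `χ(g) = 1` then `χ = 1`. [folklore] -/
theorem eq_one_of_apply_gen [NeZero q] {g : ZMod q} {m : ℕ} (hg : ∀ u : (ZMod q)ˣ, ∃ k < m, (u : ZMod q) = g ^ k)
    {χ : DirichletCharacter ℂ q} (h : χ g = 1) : χ = 1 := by
  ext u
  obtain ⟨k, -, hk⟩ := hg u
  rw [MulChar.one_apply_coe, hk, map_pow, h, one_pow]

/-- A real character takes the values `±1` at a point whose value is non-zero. [folklore] -/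
theorem apply_eq_one_or_neg_one {χ : DirichletCharacter ℂ q} (hreal : MulChar.IsQuadratic χ) {x : ZMod q}
    (hx : χ x ≠ 0) : χ x = 1 ∨ χ x = -1 := by
  rcases hreal x with h | h | h
  · exact absurd h hx
  · exact Or.inl h
  · exact Or.inr h

/-- `χ x ≠ 0` when `x · y = 1` for some `y`. [folklore] -/
theorem apply_ne_zero_of_mul_eq_one {χ : DirichletCharacter ℂ q} {x y : ZMod q} (h : x * y = 1) : χ x ≠ 0 := by
  intro h0
  have : χ (x * y) = 1 := by rw [h, map_one]
  rw [map_mul, h0, zero_mul] at this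
  exact zero_ne_one this

/-- A power of `−1` is `±1` — so `χ(g) = −1` on a cyclic unit group makes `χ` real. [folklore] -/
theorem isQuadratic_of_apply_gen_neg_one [NeZero q] {g : ZMod q} {m : ℕ} (hg : ∀ u : (ZMod q)ˣ, ∃ k < m, (u : ZMod q) = g ^ k)
    {χ : DirichletCharacter ℂ q} (h : χ g = -1) : MulChar.IsQuadratic χ := by
  intro x
  by_cases hx : IsUnit x
  · obtain ⟨u, rfl⟩ := hx
    obtain ⟨k, -, hk⟩ := hg u
    right
    rw [hk, map_pow, h]
    rcases Nat.even_or_odd k with he | ho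
    · left; exact he.neg_one_pow
    · right; exact ho.neg_one_pow
  · left; exact χ.map_nonunit hx

/-! ## Generators (by `decide`) -/

/-- `(ℤ/5)ˣ = ⟨2⟩`. [folklore] -/
theorem units_mod_five_gen : ∀ u : (ZMod 5)ˣ, ∃ k < 4, (u : ZMod 5) = 2 ^ k := by decide
/-- `(ℤ/7)ˣ = ⟨3⟩`. [folklore] -/
theorem units_mod_seven_gen : ∀ u : (ZMod 7)ˣ, ∃ k < 6, (u : ZMod 7) = 3 ^ k := by decide
/-- `(ℤ/9)ˣ = ⟨2⟩`. [folklore] -/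
theorem units_mod_nine_gen : ∀ u : (ZMod 9)ˣ, ∃ k < 6, (u : ZMod 9) = 2 ^ k := by decide
/-- `(ℤ/11)ˣ = ⟨2⟩`. [folklore] -/
theorem units_mod_eleven_gen : ∀ u : (ZMod 11)ˣ, ∃ k < 10, (u : ZMod 11) = 2 ^ k := by decide
/-- `(ℤ/13)ˣ = ⟨2⟩`. [folklore] -/
theorem units_mod_thirteen_gen : ∀ u : (ZMod 13)ˣ, ∃ k < 12, (u : ZMod 13) = 2 ^ k := by decide
/-- `(ℤ/14)ˣ = ⟨3⟩`. [folklore] -/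
theorem units_mod_fourteen_gen : ∀ u : (ZMod 14)ˣ, ∃ k < 6, (u : ZMod 14) = 3 ^ k := by decide
/-- `(ℤ/17)ˣ = ⟨3⟩`. [folklore] -/
theorem units_mod_seventeen_gen : ∀ u : (ZMod 17)ˣ, ∃ k < 16, (u : ZMod 17) = 3 ^ k := by decide
/-- `(ℤ/19)ˣ = ⟨2⟩`. [folklore] -/
theorem units_mod_nineteen_gen : ∀ u : (ZMod 19)ˣ, ∃ k < 18, (u : ZMod 19) = 2 ^ k := by decide
/-- `(ℤ/23)ˣ = ⟨5⟩`. [folklore] -/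
theorem units_mod_twentythree_gen : ∀ u : (ZMod 23)ˣ, ∃ k < 22, (u : ZMod 23) = 5 ^ k := by decide
/-- `(ℤ/25)ˣ = ⟨2⟩`. [folklore] -/
theorem units_mod_twentyfive_gen : ∀ u : (ZMod 25)ˣ, ∃ k < 20, (u : ZMod 25) = 2 ^ k := by decide
/-- `(ℤ/27)ˣ = ⟨2⟩`. [folklore] -/
theorem units_mod_twentyseven_gen : ∀ u : (ZMod 27)ˣ, ∃ k < 18, (u : ZMod 27) = 2 ^ k := by decide
/-- `(ℤ/29)ˣ = ⟨2⟩`. [folklore] -/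
theorem units_mod_twentynine_gen : ∀ u : (ZMod 29)ˣ, ∃ k < 28, (u : ZMod 29) = 2 ^ k := by decide
/-- `(ℤ/8)ˣ = {1, 3, 5, 3·5}`. [folklore] -/
theorem units_mod_eight : ∀ u : (ZMod 8)ˣ, (u : ZMod 8) = 1 ∨ (u : ZMod 8) = 3 ∨ (u : ZMod 8) = 5 ∨ (u : ZMod 8) = 3 * 5 := by
  decide
/-- `(ℤ/15)ˣ = ⟨2⟩ × ⟨11⟩`. [folklore] -/
theorem units_mod_fifteen : ∀ u : (ZMod 15)ˣ, ∃ k < 4, (u : ZMod 15) = 2 ^ k ∨ (u : ZMod 15) = 2 ^ k * 11 := by decide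
/-- `(ℤ/16)ˣ = ⟨5⟩ × ⟨15⟩`. [folklore] -/
theorem units_mod_sixteen : ∀ u : (ZMod 16)ˣ, ∃ k < 4, (u : ZMod 16) = 5 ^ k ∨ (u : ZMod 16) = 5 ^ k * 15 := by decide
/-- `(ℤ/21)ˣ = ⟨2⟩ × ⟨20⟩`. [folklore] -/
theorem units_mod_twentyone : ∀ u : (ZMod 21)ˣ, ∃ k < 6, (u : ZMod 21) = 2 ^ k ∨ (u : ZMod 21) = 2 ^ k * 20 := by decide

/-! ## Kernels of reductions and factorisations -/

/-- The reduction `(ℤ/6)ˣ → (ℤ/3)ˣ` is injective. [folklore] -/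
theorem ker_unitsMap_six_three : ∀ x : (ZMod 6)ˣ, ZMod.unitsMap (show 3 ∣ 6 by norm_num) x = 1 → x = 1 := by decide
/-- The reduction `(ℤ/10)ˣ → (ℤ/5)ˣ` is injective. [folklore] -/
theorem ker_unitsMap_ten_five : ∀ x : (ZMod 10)ˣ, ZMod.unitsMap (show 5 ∣ 10 by norm_num) x = 1 → x = 1 := by decide
/-- The kernel of `(ℤ/9)ˣ → (ℤ/3)ˣ` is `{1, 2², 2⁴}`. [folklore] -/
theorem ker_unitsMap_nine_three : ∀ x : (ZMod 9)ˣ, ZMod.unitsMap (show 3 ∣ 9 by norm_num) x = 1 →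
    (x : ZMod 9) = 1 ∨ (x : ZMod 9) = 2 ^ 2 ∨ (x : ZMod 9) = 2 ^ 4 := by decide
/-- The kernel of `(ℤ/15)ˣ → (ℤ/5)ˣ` is `{1, 11}`. [folklore] -/
theorem ker_unitsMap_fifteen_five : ∀ x : (ZMod 15)ˣ, ZMod.unitsMap (show 5 ∣ 15 by norm_num) x = 1 →
    (x : ZMod 15) = 1 ∨ (x : ZMod 15) = 11 := by decide
/-- The kernel of `(ℤ/8)ˣ → (ℤ/4)ˣ` is `{1, 5}`. [folklore] -/
theorem ker_unitsMap_eight_four : ∀ x : (ZMod 8)ˣ, ZMod.unitsMap (show 4 ∣ 8 by norm_num) x = 1 →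
    (x : ZMod 8) = 1 ∨ (x : ZMod 8) = 5 := by decide
/-- The kernel of `(ℤ/16)ˣ → (ℤ/8)ˣ` is `{1, 9} = {1, 5²}`. [folklore] -/
theorem ker_unitsMap_sixteen_eight : ∀ x : (ZMod 16)ˣ, ZMod.unitsMap (show 8 ∣ 16 by norm_num) x = 1 →
    (x : ZMod 16) = 1 ∨ (x : ZMod 16) = 5 ^ 2 := by decide

/-- Every character mod 6 is induced from a character mod 3. [folklore] -/
theorem factorsThrough_six_three (χ : DirichletCharacter ℂ 6) : χ.FactorsThrough 3 := by
  rw [factorsThrough_iff_ker_unitsMap (show 3 ∣ 6 by norm_num)]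
  intro x hx
  rw [MonoidHom.mem_ker] at hx ⊢
  rw [ker_unitsMap_six_three x hx, map_one]

/-- Every character mod 10 is induced from a character mod 5. [folklore] -/
theorem factorsThrough_ten_five (χ : DirichletCharacter ℂ 10) : χ.FactorsThrough 5 := by
  rw [factorsThrough_iff_ker_unitsMap (show 5 ∣ 10 by norm_num)]
  intro x hx
  rw [MonoidHom.mem_ker] at hx ⊢
  rw [ker_unitsMap_ten_five x hx, map_one]

/-- A character mod 9 with `χ(2)² = 1` is induced from a character mod 3. [folklore] -/
theorem factorsThrough_nine_three (χ : DirichletCharacter ℂ 9) (h4 : χ (2 : ZMod 9) ^ 2 = 1) : χ.FactorsThrough 3 := by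
  rw [factorsThrough_iff_ker_unitsMap (show 3 ∣ 9 by norm_num)]
  intro x hx
  rw [MonoidHom.mem_ker] at hx ⊢
  apply Units.ext
  rw [MulChar.coe_toUnitHom, Units.val_one]
  rcases ker_unitsMap_nine_three x hx with h | h | h <;> rw [h]
  · exact map_one χ
  · rw [map_pow, h4]
  · rw [map_pow, show 4 = 2 * 2 from rfl, pow_mul, h4, one_pow]

/-- A character mod 15 with `χ(11) = 1` is induced from a character mod 5. [folklore] -/
theorem factorsThrough_fifteen_five (χ : DirichletCharacter ℂ 15) (h11 : χ (11 : ZMod 15) = 1) : χ.FactorsThrough 5 := by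
  rw [factorsThrough_iff_ker_unitsMap (show 5 ∣ 15 by norm_num)]
  intro x hx
  rw [MonoidHom.mem_ker] at hx ⊢
  apply Units.ext
  rw [MulChar.coe_toUnitHom, Units.val_one]
  rcases ker_unitsMap_fifteen_five x hx with h | h <;> rw [h]
  · exact map_one χ
  · exact h11

/-- A character mod 8 with `χ(5) = 1` is induced from a character mod 4. [folklore] -/
theorem factorsThrough_eight_four (χ : DirichletCharacter ℂ 8) (h5 : χ (5 : ZMod 8) = 1) : χ.FactorsThrough 4 := by
  rw [factorsThrough_iff_ker_unitsMap (show 4 ∣ 8 by norm_num)]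
  intro x hx
  rw [MonoidHom.mem_ker] at hx ⊢
  apply Units.ext
  rw [MulChar.coe_toUnitHom, Units.val_one]
  rcases ker_unitsMap_eight_four x hx with h | h <;> rw [h]
  · exact map_one χ
  · exact h5

/-- A character mod 16 with `χ(5)² = 1` is induced from a character mod 8. [folklore] -/
theorem factorsThrough_sixteen_eight (χ : DirichletCharacter ℂ 16) (h25 : χ (5 : ZMod 16) ^ 2 = 1) : χ.FactorsThrough 8 := by
  rw [factorsThrough_iff_ker_unitsMap (show 8 ∣ 16 by norm_num)]
  intro x hx
  rw [MonoidHom.mem_ker] at hx ⊢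
  apply Units.ext
  rw [MulChar.coe_toUnitHom, Units.val_one]
  rcases ker_unitsMap_sixteen_eight x hx with h | h <;> rw [h]
  · exact map_one χ
  · rw [map_pow, h25]

end Summit.Ventures.WeilGRH.RealCharacterSmallModuli

end

/-! ### Build note
weil-grh-2 gen11, 2026-08-24 (lead R14-3 APPEND REMEDY): append-only re-commit of the file accepted as p374638 (2026-08-24T01:48Z) so that the hub
builder produces its olean (no olean 8 h after acceptance; importer probes answer `remote:stale:…:unbuilt`).  No declaration is added or changed. -/
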